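import Mathlib.Analysis.Calculus.BumpFunction.Convolution
import Mathlib.Analysis.Calculus.BumpFunction.FiniteDimension
import Summits.AtomisticToContinuum.Crystallization.Theorems.FreeSplittingCertificatesStrictSplittingRuleFarPencilGrowthIntegral

/-!
# `StrictSplittingRule` (stmt-AtomisticToContinuum-12560): mollification PRESERVES AFFINE TAILS (first brick of the density route of the far-lemma transfer)

Route `FreeSplittingCertificates`, crux r3 `StrictSplittingRule` (H12⋆ = `stub_coreJointCoercive`), unit b2b-freesplit-B gen 12.
VALUE = a calculus brick for HOME FAR-LEMMA-SPEC §10 (e) — NOT a proof of H12⋆, NOT summit progress.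

The far theorem `farPencil_weighted_integral_le_of_affineTail` (…FarPencilGrowthIntegral) wants a `C²` field that is AFFINE outside a ball.  The lattice→continuum
transfer produces only a continuous piecewise-affine interpolant `ṽ`; the density route replaces it by `φ_ε ⋆ ṽ` with a normed bump `φ_ε` and passes to the limit.  For that,
the mollified field must again be affine outside a (slightly larger) ball, with the SAME affine map.  This file proves exactly that:
* `integral_normed_smul_clm_eq_zero`: `∫ φ̃(t) • L t dt = 0` for a normed bump `φ̃` centred at `0` and any continuous linear `L` (symmetry `φ̃(−t) = φ̃(t)`);
* `normed_convolution_eq_right_of_affine`: if `g x = g x₀ + L (x − x₀)` on `ball x₀ φ.rOut` then `(φ̃ ⋆ g) x₀ = g x₀` (Mathlib has the locally-constant case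
  `ContDiffBump.normed_convolution_eq_right`);
* **`mollify_affineTail`**: if `v y = b + y·A` for `‖y‖ ≥ R` then `(φ̃ ⋆ v) y = b + y·A` for `‖y‖ ≥ R + φ.rOut` — in the coordinates of `…FarPencilGrowthIntegral`.
-/

noncomputable section

open MeasureTheory Topology Filter ContinuousLinearMap Metric
open scoped Convolution

namespace Summit.AtomisticToContinuum.Crystallization.Theorems.StrictSplittingRuleBirth

variable {F : Type*} [NormedAddCommGroup F] [NormedSpace ℝ F] [CompleteSpace F]

omit [CompleteSpace F] in
/-- **First moment of a normed bump vanishes**: `∫ φ̃(t) • L t dt = 0` for every continuous linear `L` (the bump is even). -/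
theorem integral_normed_smul_clm_eq_zero (φ : ContDiffBump (0 : Fin 3 → ℝ)) (L : (Fin 3 → ℝ) →L[ℝ] F) :
    ∫ t, φ.normed volume t • L t = 0 := by
  have h := integral_neg_eq_self (fun t : Fin 3 → ℝ => φ.normed volume t • L t) volume
  have h2 : (fun t : Fin 3 → ℝ => φ.normed volume (-t) • L (-t)) = fun t => -(φ.normed volume t • L t) := by
    funext t
    rw [φ.normed_neg, map_neg, smul_neg]
  rw [h2, integral_neg] at h
  -- h : -I = I
  have h3 : (2 : ℝ) • (∫ t, φ.normed volume t • L t) = 0 := by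
    rw [two_smul]
    nth_rewrite 1 [← h]
    exact neg_add_cancel _
  rcases smul_eq_zero.1 h3 with h4 | h4
  · norm_num at h4
  · exact h4

/-- **Convolution with a normed bump fixes affine functions**: if `g x = g x₀ + L (x − x₀)` on the ball `ball x₀ φ.rOut`, then `(φ̃ ⋆ g) x₀ = g x₀`. -/
theorem normed_convolution_eq_right_of_affine (φ : ContDiffBump (0 : Fin 3 → ℝ)) {g : (Fin 3 → ℝ) → F} {x₀ : Fin 3 → ℝ}
    (L : (Fin 3 → ℝ) →L[ℝ] F) (hg : ∀ x ∈ ball x₀ φ.rOut, g x = g x₀ + L (x - x₀)) :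
    (φ.normed volume ⋆[lsmul ℝ ℝ, volume] g) x₀ = g x₀ := by
  rw [convolution_lsmul]
  have hpt : (fun t => φ.normed volume t • g (x₀ - t)) = fun t => φ.normed volume t • g x₀ - φ.normed volume t • L t := by
    funext t
    by_cases ht : φ.normed volume t = 0
    · simp [ht]
    · have hmem : t ∈ Function.support (φ.normed volume) := ht
      rw [φ.support_normed_eq] at hmem
      have hball : x₀ - t ∈ ball x₀ φ.rOut := by
        rw [mem_ball, dist_eq_norm, sub_sub_cancel_left, norm_neg]
        simpa [mem_ball, dist_zero_right] using hmem
      rw [hg _ hball, sub_sub_cancel_left, map_neg, smul_add, smul_neg, sub_eq_add_neg]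
  have i1 : Integrable (fun t : Fin 3 → ℝ => φ.normed volume t • g x₀) := (φ.integrable_normed).smul_const _
  have i2 : Integrable (fun t : Fin 3 → ℝ => φ.normed volume t • L t) :=
    (φ.continuous_normed.smul L.continuous).integrable_of_hasCompactSupport (φ.hasCompactSupport_normed.smul_right)
  rw [hpt, integral_sub i1 i2, φ.integral_normed_smul volume (g x₀), integral_normed_smul_clm_eq_zero, sub_zero]

/-- **Mollification preserves affine tails.**  If `v y = b + y·A` (coordinates: `v y j = b j + Σᵢ yᵢ Aᵢⱼ`) for all `‖y‖ ≥ R` (sup norm), then for every normed bump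
`φ` centred at `0`, the mollified field `φ̃ ⋆ v` satisfies the same identity for `‖y‖ ≥ R + φ.rOut` — so `farPencil_weighted_integral_le_of_affineTail` applies to
`φ̃ ⋆ v` with radius `R + φ.rOut` (given `C²`, which `HasCompactSupport.contDiff_convolution_left` provides for locally integrable `v`). -/
theorem mollify_affineTail (φ : ContDiffBump (0 : Fin 3 → ℝ)) {v : (Fin 3 → ℝ) → (Fin 3 → ℝ)} {R : ℝ} {b : Fin 3 → ℝ}
    {A : Fin 3 → Fin 3 → ℝ} (htail : ∀ y : Fin 3 → ℝ, R ≤ ‖y‖ → ∀ j, v y j = b j + (y 0 * A 0 j + y 1 * A 1 j + y 2 * A 2 j))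
    (y : Fin 3 → ℝ) (hy : R + φ.rOut ≤ ‖y‖) (j : Fin 3) :
    (φ.normed volume ⋆[lsmul ℝ ℝ, volume] v) y j = b j + (y 0 * A 0 j + y 1 * A 1 j + y 2 * A 2 j) := by
  -- the linear part as a continuous linear map
  let Lₗ : (Fin 3 → ℝ) →ₗ[ℝ] (Fin 3 → ℝ) :=
    { toFun := fun z k => z 0 * A 0 k + z 1 * A 1 k + z 2 * A 2 k
      map_add' := fun z w => by funext k; simp only [Pi.add_apply]; ring
      map_smul' := fun c z => by funext k; simp only [Pi.smul_apply, smul_eq_mul, RingHom.id_apply]; ring }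
  let L : (Fin 3 → ℝ) →L[ℝ] (Fin 3 → ℝ) := LinearMap.toContinuousLinearMap Lₗ
  have hLapp : ∀ z k, L z k = z 0 * A 0 k + z 1 * A 1 k + z 2 * A 2 k := fun z k => rfl
  have hyR : R ≤ ‖y‖ := le_trans (by linarith [φ.rOut_pos.le]) hy
  have hg : ∀ x ∈ ball y φ.rOut, v x = v y + L (x - y) := by
    intro x hx
    have hxR : R ≤ ‖x‖ := by
      have h1 : dist x y < φ.rOut := mem_ball.1 hx
      have h2 : ‖y‖ - ‖x‖ ≤ dist x y := by
        rw [dist_comm, dist_eq_norm]; exact norm_sub_norm_le y x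
      linarith
    funext k
    rw [Pi.add_apply, htail x hxR k, htail y hyR k, hLapp, Pi.sub_apply, Pi.sub_apply, Pi.sub_apply]
    ring
  have h := normed_convolution_eq_right_of_affine φ L hg
  rw [h, htail y hyR j]

end Summit.AtomisticToContinuum.Crystallization.Theorems.StrictSplittingRuleBirth
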